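/-
Copyright: statement-level skeleton of a published paper (lit-balaban cell, Phase-2 proof seat p30, gen 2). No proof
claims beyond what the kernel checks below.
-/
import Literature.MathematicalPhysics.QuantumFieldTheory.BalabanImbrieJaffe1984to88.BIJ85AppAStatements
import Literature.MathematicalPhysics.QuantumFieldTheory.BalabanImbrieJaffe1984to88.BIJ85AppALemmas

/-!
# `BalabanImbrieJaffe1984to88.BIJ85PropA3Proof` — T. Bałaban, J. Imbrie, A. Jaffe, *Renormalization of the Higgs model:
minimizers, propagators and the stability of mean field theory*, Commun. Math. Phys. **97** (1985) 299–329
[BalabanImbrieJaffe1985]: Appendix "Quadratic Forms" pp. 327–329 — **Proposition A3** (A13)–(A16) PROVED for the printed data (the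
constrained Gaussian integral (A7) over ℋ₀ = Null V in finite dimension), along the printed proof (A17)–(A19); kind «model-instance»:
r15's abstract carrier `ConstrainedForm` instantiated by the printed objects satisfies `ConstrainedForm.PropA3`

statement-level skeleton of published theorems with citation tags; proofs where landed; nothing here is a claim about the Yang–Mills mass gap

PDF held: `paper:balaban1985-cmp97-bij-higgs-minimizers` (journal page = PDF page + 298).  Renders read as images: pp. 327–329
(`HOME/lit-balaban-r15/pages/1985-cmp97-bij-higgs-minimizers-p029-x2.png`, `…-p030-x2.png`, `…-p031-x2.png`).

CITATION HEADER (lean-in-tree rule).  Part of the lit-balaban TYPED SKELETON (HOME `run/shared/lean/pub/lit-balaban/`): WHAT IS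
REPRODUCED = row **C1.PropA3** of `HOME/lit-balaban-r15/ROWS-C1-part2.md` (`typed p239653`: `ConstrainedForm.EqA13`, `.EqA14`,
`.EqA15A16`, `.PropA3` over an ABSTRACT carrier whose fields G, P, C are unconstrained data) — here the MODEL INSTANCE `model` (ℋ, ⟨,⟩,
ℋ₀ = Null V, Δ, V as printed; Δ₀, G, P, C pinned down by their printed definitions (A8), (A11), (A12), (A7)) is shown to satisfy
`PropA3` (`propA3_model`), together with the Gaussian statement of (A15) (`eqA15`); p30 gen 1's `BIJ85Eq611Proof.eq611` ((6.1.1))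
takes exactly `ConstrainedForm.EqA15A16` as its hypothesis `hA16`.  Third of three Appendix-A files of seat p30 gen 2 (imports
`BIJ85AppALemmas`: the Gaussian mechanism and the objects G, P); unit `lit-balaban-p30`.

THE PRINTED TEXT (verbatim, pp. 327–329 [PDF 29–31]).  *"Define the transformation C on ℋ by exp(½⟨B,CB⟩) = Z⁻¹∫_{ℋ₀} exp(−½⟨x,Δx⟩
+ ⟨x,B⟩)dx. (A7)  Clearly C is self-adjoint in the inner product ⟨ , ⟩. Furthermore, define Δ₀ = Δ↾ℋ₀. (A8) … Let us make the
following assumptions: Let V be given and I ≤ Δ₀ on ℋ₀, (A9)  I ≤ Δ + V on ℋ, (A10) where ℋ₀ = Null V. With these definitions,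
define G = (Δ+V)⁻¹ (A11) and let ( , ) be the inner product (x,y) ≡ ⟨x,(Δ+V)y⟩. (A12)  Then let P denote the projection of ℋ onto
ℋ₀, where P is orthogonal in the inner product (A12).  Proposition A3. Under the assumptions above, C = PG, (A13) so Range C ⊂ ℋ₀.
Furthermore CΔ₀C = C, (A14) and HB = CB = Z⁻¹∫_{ℋ₀} exp(−½⟨x,Δx⟩ + ⟨x,B⟩)x dx (A15) is the minimum configuration of ½⟨x,Δx⟩ −
⟨x,B⟩, x ∈ ℋ₀. Thus with x = y + CB, ½⟨x,Δx⟩ − ⟨x,B⟩ = ½⟨y,Δy⟩ − ½⟨B,CB⟩, x ∈ ℋ₀. (A16)  Proof. For x ∈ ℋ₀, note that … Thus (A7)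
can be written exp(½⟨B,CB⟩) = Z⁻¹∫_{ℋ₀} exp(−½⟨x−PGB,(Δ+V)(x−PGB)⟩ + ½⟨PGB,(Δ+V)PGB⟩)dx, (A17) where we have used ⟨PGB,(Δ+V)x⟩ =
(PGB,x) = (GB,Px) = (GB,x) = ⟨GB,(Δ+V)x⟩. (A18)  Thus (A17) equals exp(½⟨PGB,(Δ+V)PGB⟩) = exp(½⟨GB,(Δ+V)PGB⟩) = exp(½⟨B,PGB⟩).
Thus ⟨B,CB⟩ = ⟨B,PGB⟩, and (A13) holds as claimed. To verify (A14), note that CΔ₀C = PGΔ₀PG = PG(Δ+V)PG = P²G = PG = C.  Next note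
that (A17) displays CB as the minimum of ½⟨x,Δx⟩ − ⟨x,B⟩, since linear terms in the fluctuation x − PGB do not occur. Also from
(A18) we have for x ∈ ℋ₀, ⟨CB,Δx⟩ = ⟨B,x⟩, (A19) so the integral in (A15) equals CB. Finally … which is (A16)."*

THE TYPING.  ℋ = a finite-dimensional real inner product space `H` (p. 326: *"Since we work with lattice fields, our space ℋ is
finite dimensional"*), dx on ℋ₀ = the Lebesgue (`volume`) measure of the subspace ℋ₀ = `LinearMap.ker V` with its induced inner
product; Δ, V symmetric (`hΔ`, `hV`) with (A9) `hA9` as printed ((A10) enters only the existence of G and P, `BIJ85AppALemmas.exists_G`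
/ `exists_P`); G = INPUT DATA characterised by (A11) `hG : (Δ+V)G = I`; P = INPUT DATA characterised by its printed definition
`hP0 : Px ∈ ℋ₀`, `hP : (x − Px, y) = 0 (y ∈ ℋ₀)` in the inner product (A12) (unique: `BIJ85AppALemmas.P_unique`); C = INPUT DATA
characterised by its DEFINITION (A7) `hC7` (Z = ∫_{ℋ₀}exp(−½⟨x,Δx⟩)dx) and by *"Clearly C is self-adjoint"* `hC`; Δ₀ = any operator
of ℋ agreeing with Δ on ℋ₀ (A8) `hΔ₀` (r15's carrier field).  WHAT IS PROVED: **(A18)** `eqA18`, **(A19)** `eqA19`, PG is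
⟨,⟩-symmetric `PG_symm`, the completed square **(A16)/(A17)** `eqA16`, minimality `PG_min`; the (A7)-integrand is integrable over ℋ₀
under (A9) `integrable_A7`, Z > 0 `Z_pos`; (A17) evaluated: PG SATISFIES the defining relation (A7) `eqA7_PG` (so the definition (A7)
is consistent); *"Thus ⟨B,CB⟩ = ⟨B,PGB⟩"* `inner_C_eq`; **(A13)** `eqA13` (C = PG, by injectivity of exp and polarisation) and *"Range
C ⊂ ℋ₀"* `C_mem_H0`; **(A14)** `eqA14` via r15's kernel-checked chain `ConstrainedForm.eqA14_of_A13`; **(A15)** `eqA15`: the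
Gaussian MEAN over ℋ₀ is CB — TRANSCRIPT NOTE T5: the printed Z⁻¹ in (A15) must be read Z(B)⁻¹, Z(B) = ∫_{ℋ₀}exp(−½⟨x,Δx⟩ + ⟨x,B⟩)dx
(as the same paper writes in (4.1.3)–(4.1.4), H_{k,Ax}B = Z_{k,Ax}(B)⁻¹∫…); with the B-independent Z of (A7) the right side of
(A15) equals exp(½⟨B,CB⟩)·CB — both forms proved (`eqA15`, `eqA15_Z`); and **Proposition A3** assembled: `propA3_model :
(model Δ V Δ₀ G P C).PropA3`.  Carrier clauses (F6): none beyond Mathlib's inner-product-space and Lebesgue-measure structures;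
NOTHING of the paper is asserted beyond the kernel-checked statements below.
-/

open scoped RealInnerProductSpace
open MeasureTheory

namespace Literature.MathematicalPhysics.QuantumFieldTheory.BalabanImbrieJaffe1984to88.BIJ85PropA3Proof

open BIJ85AppAStatements BIJ85AppALemmas

/-! ## Proposition A3 pp. 328–329 for the printed data -/

section PropA3

variable {H : Type} [NormedAddCommGroup H] [InnerProductSpace ℝ H]

variable (Δ V : H →ₗ[ℝ] H)

/-- THE MODEL INSTANCE of r15's carrier `ConstrainedForm` built from the printed objects: ℋ = `H`, ⟨,⟩, ℋ₀ = Null V, Δ, V,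
Δ₀ (A8), G (A11), P (A12), C (A7) — the latter four as data pinned down by their printed definitions in the theorems below.
[cite: BalabanImbrieJaffe1985, Prop. A3 (A7)–(A12) pp.327–328] -/
def model (Δ₀ G P C : H →ₗ[ℝ] H) : ConstrainedForm where
  H := H
  ip := fun x y => ⟪x, y⟫
  inH0 := fun x => V x = 0
  Δ := Δ
  V := V
  Δ₀ := Δ₀
  G := G
  P := P
  C := C

variable {Δ V}

section Hyps

/-! ### Standing hypotheses of Prop. A3 (p. 328) and the printed definitions of G, P -/

variable (hΔ : ∀ x y : H, ⟪Δ x, y⟫ = ⟪x, Δ y⟫) (hV : ∀ x y : H, ⟪V x, y⟫ = ⟪x, V y⟫)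
  (hA9 : ∀ x : H, V x = 0 → ‖x‖ ^ 2 ≤ ⟪x, Δ x⟫)
  (G : H →ₗ[ℝ] H) (hG : ∀ x, (Δ + V) (G x) = x)
  (P : H →ₗ[ℝ] H) (hP0 : ∀ x, V (P x) = 0) (hP : ∀ x y : H, V y = 0 → ⟪x - P x, (Δ + V) y⟫ = 0)

include hΔ hV in
/-- Δ + V is symmetric. [cite: BalabanImbrieJaffe1985, (A12) p.328] -/
theorem S_symm (x y : H) : ⟪(Δ + V) x, y⟫ = ⟪x, (Δ + V) y⟫ := by
  simp only [LinearMap.add_apply, inner_add_left, inner_add_right, hΔ, hV]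

include hΔ hV hG hP in
/-- **(A18)** p. 328 [PDF 30], verbatim: *"⟨PGB,(Δ+V)x⟩ = (PGB,x) = (GB,Px) = (GB,x) = ⟨GB,(Δ+V)x⟩"* for x ∈ ℋ₀ — and the
last term is ⟨B,x⟩ by (A11). [cite: BalabanImbrieJaffe1985, (A18) p.328] -/
theorem eqA18 (B x : H) (hx : V x = 0) : ⟪P (G B), (Δ + V) x⟫ = ⟪B, x⟫ := by
  have h1 : ⟪P (G B), (Δ + V) x⟫ = ⟪G B, (Δ + V) x⟫ := by
    have h := hP (G B) x hx
    rw [inner_sub_left, sub_eq_zero] at h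
    exact h.symm
  rw [h1, ← S_symm hΔ hV, hG]

include hΔ hV hG hP0 hP in
/-- **(A19)** p. 329 [PDF 31], verbatim: *"Also from (A18) we have for x ∈ ℋ₀, ⟨CB,Δx⟩ = ⟨B,x⟩ (A19)"* with CB = PGB; stated as
the normal equation ⟨Δ(PGB), x⟩ = ⟨B, x⟩ on ℋ₀. [cite: BalabanImbrieJaffe1985, (A19) p.329] -/
theorem eqA19 (B x : H) (hx : V x = 0) : ⟪Δ (P (G B)), x⟫ = ⟪B, x⟫ := by
  have h := eqA18 hΔ hV G hG P hP B x hx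
  rw [← S_symm hΔ hV, LinearMap.add_apply, hP0, add_zero] at h
  exact h

include hΔ hV hG hP0 hP in
/-- PG is symmetric in ⟨ , ⟩ (needed with *"Clearly C is self-adjoint"* to pass from the quadratic forms of (A17) to the
operator identity (A13)). [cite: BalabanImbrieJaffe1985, (A13) p.328] -/
theorem PG_symm (B B' : H) : ⟪P (G B), B'⟫ = ⟪B, P (G B')⟫ := by
  have h1 := eqA19 hΔ hV G hG P hP0 hP B' (P (G B)) (hP0 _)
  have h2 := eqA19 hΔ hV G hG P hP0 hP B (P (G B')) (hP0 _)
  calc ⟪P (G B), B'⟫ = ⟪B', P (G B)⟫ := real_inner_comm _ _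
    _ = ⟪Δ (P (G B')), P (G B)⟫ := h1.symm
    _ = ⟪P (G B'), Δ (P (G B))⟫ := hΔ _ _
    _ = ⟪Δ (P (G B)), P (G B')⟫ := real_inner_comm _ _
    _ = ⟪B, P (G B')⟫ := h2

include hΔ hV hG hP0 hP in
/-- **(A16)/(A17)** p. 328 [PDF 30]: for x ∈ ℋ₀, with y = x − PGB, ½⟨x,Δx⟩ − ⟨x,B⟩ = ½⟨y,Δy⟩ − ½⟨B,PGB⟩ (the completed square
of (A17), *"linear terms in the fluctuation x − PGB do not occur"*). [cite: BalabanImbrieJaffe1985, (A16) p.328] -/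
theorem eqA16 (B x : H) (hx : V x = 0) :
    (1 / 2 : ℝ) * ⟪x, Δ x⟫ - ⟪x, B⟫
      = (1 / 2 : ℝ) * ⟪x - P (G B), Δ (x - P (G B))⟫ - (1 / 2 : ℝ) * ⟪B, P (G B)⟫ := by
  set m := P (G B) with hm
  have h1 : ⟪m, Δ x⟫ = ⟪x, B⟫ := by rw [← hΔ, eqA19 hΔ hV G hG P hP0 hP B x hx, real_inner_comm]
  have h2 : ⟪m, Δ m⟫ = ⟪B, m⟫ := by rw [← hΔ, eqA19 hΔ hV G hG P hP0 hP B m (hP0 _)]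
  have h3 : ⟪x, Δ m⟫ = ⟪x, B⟫ := by rw [← hΔ, real_inner_comm, h1]
  rw [map_sub, inner_sub_left, inner_sub_right, inner_sub_right, h1, h2, h3]
  ring

include hΔ hV hA9 hG hP0 hP in
/-- **(A15)**, minimality, p. 328 [PDF 30]: CB = PGB *"is the minimum configuration of ½⟨x,Δx⟩ − ⟨x,B⟩, x ∈ ℋ₀"* (from (A16)
and (A9)). [cite: BalabanImbrieJaffe1985, (A15) p.328] -/
theorem PG_min (B x : H) (hx : V x = 0) :
    (1 / 2 : ℝ) * ⟪P (G B), Δ (P (G B))⟫ - ⟪P (G B), B⟫ ≤ (1 / 2 : ℝ) * ⟪x, Δ x⟫ - ⟪x, B⟫ := by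
  rw [eqA16 hΔ hV G hG P hP0 hP B x hx, eqA16 hΔ hV G hG P hP0 hP B (P (G B)) (hP0 _), sub_self, map_zero,
    inner_zero_right, mul_zero]
  have hy : V (x - P (G B)) = 0 := by rw [map_sub, hx, hP0, sub_zero]
  have h := hA9 _ hy
  nlinarith [sq_nonneg ‖x - P (G B)‖]

section FinDim

variable [FiniteDimensional ℝ H]

/-! ### The Gaussian integral (A7) over ℋ₀ -/

/-- The compression of Δ to ℋ₀ = Null V, Δ_K := P₀Δι : ℋ₀ → ℋ₀ (P₀ the ⟨,⟩-orthogonal projection): its quadratic form is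
⟨x,Δx⟩ = ⟨x,Δ₀x⟩ on ℋ₀ (A8); it is the `M` of the Gaussian lemmas on the subspace. [cite: BalabanImbrieJaffe1985, (A8) p.327] -/
noncomputable def deltaK (Δ V : H →ₗ[ℝ] H) : LinearMap.ker V →ₗ[ℝ] LinearMap.ker V :=
  ((LinearMap.ker V).orthogonalProjectionOnto : H →ₗ[ℝ] LinearMap.ker V) ∘ₗ Δ ∘ₗ (LinearMap.ker V).subtype

/-- ⟨w, Δ_K w′⟩_{ℋ₀} = ⟨w, Δw′⟩ for w, w′ ∈ ℋ₀. [cite: BalabanImbrieJaffe1985, (A8) p.327] -/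
theorem inner_deltaK (w w' : LinearMap.ker V) : ⟪w, deltaK Δ V w'⟫ = ⟪(w : H), Δ w'⟫ := by
  simp only [deltaK, LinearMap.coe_comp, Function.comp_apply, Submodule.coe_subtype, ContinuousLinearMap.coe_coe,
    Submodule.inner_orthogonalProjectionOnto_eq_of_mem_left]

include hΔ in
/-- Δ_K is symmetric. [cite: BalabanImbrieJaffe1985, (A8) p.327] -/
theorem deltaK_symm (x y : LinearMap.ker V) : ⟪deltaK Δ V x, y⟫ = ⟪x, deltaK Δ V y⟫ := by
  rw [real_inner_comm, inner_deltaK, inner_deltaK, ← hΔ, real_inner_comm]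

include hA9 in
/-- (A9) = coercivity of Δ_K on ℋ₀. [cite: BalabanImbrieJaffe1985, (A9) p.328] -/
theorem deltaK_coercive (w : LinearMap.ker V) : (1 : ℝ) * ‖w‖ ^ 2 ≤ ⟪w, deltaK Δ V w⟫ := by
  rw [one_mul, inner_deltaK, Submodule.coe_norm]
  exact hA9 _ (LinearMap.mem_ker.mp w.2)

/-- The source term of (A7) seen in ℋ₀: b := P₀B with ⟨w, b⟩_{ℋ₀} = ⟨w, B⟩. [cite: BalabanImbrieJaffe1985, (A7) p.327] -/
theorem inner_projB (B : H) (w : LinearMap.ker V) :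
    ⟪w, (LinearMap.ker V).orthogonalProjectionOnto B⟫ = ⟪(w : H), B⟫ := by
  simp only [Submodule.inner_orthogonalProjectionOnto_eq_of_mem_left]

include hΔ hV hG hP0 hP in
/-- (A19) in ℋ₀-coordinates: Δ_K(PGB) = P₀B, i.e. m := PGB ∈ ℋ₀ solves Mm = b for the Gaussian lemmas.
[cite: BalabanImbrieJaffe1985, (A19) p.329] -/
theorem deltaK_PG (B : H) :
    deltaK Δ V ⟨P (G B), LinearMap.mem_ker.mpr (hP0 (G B))⟩ = (LinearMap.ker V).orthogonalProjectionOnto B := by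
  apply ext_inner_left ℝ
  intro w
  rw [inner_deltaK, inner_projB, real_inner_comm, Subtype.coe_mk, eqA19 hΔ hV G hG P hP0 hP B w (LinearMap.mem_ker.mp w.2),
    real_inner_comm]

/-- The exponent of (A7)/(A15) restricted to ℋ₀ is the Gaussian exponent of (Δ_K, P₀B).
[cite: BalabanImbrieJaffe1985, (A7) p.327] -/
theorem exponent_eq (B : H) (x : LinearMap.ker V) :
    -(1 / 2 : ℝ) * ⟪(x : H), Δ x⟫ + ⟪(x : H), B⟫
      = -(1 / 2 : ℝ) * ⟪x, deltaK Δ V x⟫ + ⟪x, (LinearMap.ker V).orthogonalProjectionOnto B⟫ := by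
  rw [inner_deltaK, inner_projB]

section Measure

variable [MeasurableSpace H] [BorelSpace H]

include hA9 in
/-- Convergence of (A7): the integrand exp(−½⟨x,Δx⟩ + ⟨x,B⟩) is Lebesgue integrable over ℋ₀ under (A9) (*"an integral such as
(A6) converges only when restricted to such a subspace"*, p. 327). [cite: BalabanImbrieJaffe1985, (A7) p.327] -/
theorem integrable_A7 (B : H) :
    Integrable (fun x : LinearMap.ker V => Real.exp (-(1 / 2 : ℝ) * ⟪(x : H), Δ x⟫ + ⟪(x : H), B⟫)) := by
  simp_rw [exponent_eq]
  exact integrable_gauss (deltaK Δ V) _ one_pos (deltaK_coercive hA9)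

include hA9 in
/-- Z = ∫_{ℋ₀}exp(−½⟨x,Δx⟩)dx > 0, the normalisation of (A7). [cite: BalabanImbrieJaffe1985, (A7) p.327] -/
theorem Z_pos : 0 < ∫ x : LinearMap.ker V, Real.exp (-(1 / 2 : ℝ) * ⟪(x : H), Δ x⟫) := by
  have h := integral_gauss_pos (deltaK Δ V) one_pos (deltaK_coercive hA9)
  simp_rw [inner_deltaK] at h
  exact h

include hΔ hV hG hP0 hP in
/-- **(A17)** p. 328 [PDF 30] evaluated: Z⁻¹∫_{ℋ₀}exp(−½⟨x,Δx⟩ + ⟨x,B⟩)dx = exp(½⟨B,PGB⟩), i.e. PG SATISFIES the defining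
relation (A7) of C (*"Thus (A17) equals exp(½⟨PGB,(Δ+V)PGB⟩) = … = exp(½⟨B,PGB⟩)"*). [cite: BalabanImbrieJaffe1985, (A17) p.328] -/
theorem eqA7_PG (B : H) :
    ∫ x : LinearMap.ker V, Real.exp (-(1 / 2 : ℝ) * ⟪(x : H), Δ x⟫ + ⟪(x : H), B⟫)
      = Real.exp ((1 / 2 : ℝ) * ⟪B, P (G B)⟫) * ∫ x : LinearMap.ker V, Real.exp (-(1 / 2 : ℝ) * ⟪(x : H), Δ x⟫) := by
  have h := integral_gauss_eq (deltaK Δ V) ((LinearMap.ker V).orthogonalProjectionOnto B) (deltaK_symm hΔ)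
    ⟨P (G B), LinearMap.mem_ker.mpr (hP0 (G B))⟩ (deltaK_PG hΔ hV G hG P hP0 hP B)
  simp_rw [← exponent_eq, inner_deltaK] at h
  rw [h, Submodule.inner_orthogonalProjectionOnto_eq_of_mem_right]

variable (C : H →ₗ[ℝ] H) (hC : ∀ x y : H, ⟪C x, y⟫ = ⟪x, C y⟫)
  (hC7 : ∀ B : H, Real.exp ((1 / 2 : ℝ) * ⟪B, C B⟫)
    = (∫ x : LinearMap.ker V, Real.exp (-(1 / 2 : ℝ) * ⟪(x : H), Δ x⟫))⁻¹
      * ∫ x : LinearMap.ker V, Real.exp (-(1 / 2 : ℝ) * ⟪(x : H), Δ x⟫ + ⟪(x : H), B⟫))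

include hΔ hV hA9 hG hP0 hP hC7 in
/-- *"Thus ⟨B,CB⟩ = ⟨B,PGB⟩"* (p. 328): the quadratic forms of C (defined by (A7)) and PG agree.
[cite: BalabanImbrieJaffe1985, (A13) p.328] -/
theorem inner_C_eq (B : H) : ⟪B, C B⟫ = ⟪B, P (G B)⟫ := by
  have h := hC7 B
  rw [eqA7_PG hΔ hV G hG P hP0 hP B, mul_left_comm, inv_mul_cancel₀ (Z_pos hA9).ne', mul_one] at h
  have h2 := Real.exp_injective h
  linarith

include hΔ hV hA9 hG hP0 hP hC hC7 in
/-- **(A13)** p. 328 [PDF 30], Prop. A3: *"C = PG, (A13) so Range C ⊂ ℋ₀"* — for the C DEFINED by the Gaussian integral (A7)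
over ℋ₀ (and *"Clearly C is self-adjoint"*), G of (A11), P of (A12); by (A17)–(A18), injectivity of exp and polarisation.
[cite: BalabanImbrieJaffe1985, Prop. A3 (A13) p.328] -/
theorem eqA13 : C = P ∘ₗ G := by
  -- T := C − PG is symmetric with vanishing quadratic form, hence zero (polarisation)
  have hq : ∀ B : H, ⟪B, (C - P ∘ₗ G) B⟫ = 0 := fun B => by
    rw [LinearMap.sub_apply, inner_sub_right, inner_C_eq hΔ hV hA9 G hG P hP0 hP C hC7 B, LinearMap.comp_apply, sub_self]
  have hT : ∀ x y : H, ⟪(C - P ∘ₗ G) x, y⟫ = ⟪x, (C - P ∘ₗ G) y⟫ := fun x y => by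
    simp only [LinearMap.sub_apply, LinearMap.comp_apply, inner_sub_left, inner_sub_right, hC,
      PG_symm hΔ hV G hG P hP0 hP]
  have hzero : ∀ x y : H, ⟪x, (C - P ∘ₗ G) y⟫ = 0 := fun x y => by
    have h1 := hq (x + y)
    rw [map_add, inner_add_left, inner_add_right, inner_add_right, hq x, hq y, ← hT x y, real_inner_comm] at h1
    rw [← hT, real_inner_comm]
    linarith
  rw [← sub_eq_zero]
  ext y
  exact ext_inner_left ℝ fun x => by rw [hzero x y, LinearMap.zero_apply, inner_zero_right]

include hΔ hV hA9 hG hP0 hP hC hC7 in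
/-- *"so Range C ⊂ ℋ₀"* (p. 328). [cite: BalabanImbrieJaffe1985, Prop. A3 (A13) p.328] -/
theorem C_mem_H0 (B : H) : V (C B) = 0 := by
  rw [eqA13 hΔ hV hA9 G hG P hP0 hP C hC hC7, LinearMap.comp_apply]
  exact hP0 _

include hΔ hV hA9 hG hP0 hP hC hC7 in
/-- **(A14)** p. 328 [PDF 30], Prop. A3: *"CΔ₀C = C"* for any Δ₀ agreeing with Δ on ℋ₀ (A8), via r15's kernel-checked chain
`eqA14_of_A13` *"CΔ₀C = PGΔ₀PG = PG(Δ+V)PG = P²G = PG = C"*. [cite: BalabanImbrieJaffe1985, Prop. A3 (A14) p.328] -/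
theorem eqA14 (Δ₀ : H →ₗ[ℝ] H) (hΔ₀ : ∀ x : H, V x = 0 → Δ₀ x = Δ x) : C ∘ₗ Δ₀ ∘ₗ C = C := by
  have hA10P : ∀ x : H, G ((Δ + V) x) = x := by
    -- G(Δ+V) = I from (Δ+V)G = I: (Δ+V) injective by (A9) on … no: use symmetry — ⟨G(Δ+V)x − x, y⟩ via (Δ+V)G = I
    intro x
    apply ext_inner_right ℝ
    intro y
    have hy : y = (Δ + V) (G y) := (hG y).symm
    rw [hy, ← S_symm hΔ hV, hG, S_symm hΔ hV]
  have h := (model Δ V Δ₀ G P C).eqA14_of_A13 (eqA13 hΔ hV hA9 G hG P hP0 hP C hC hC7) (fun x => ?_) hA10P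
    (fun x => P_idem hA9 P hP0 hP x)
  · exact h
  · change Δ₀ (P x) = (Δ + V) (P x)
    rw [hΔ₀ _ (hP0 x), LinearMap.add_apply, hP0, add_zero]

include hΔ hV hA9 hG hP0 hP hC hC7 in
/-- **(A15)** p. 328 [PDF 30], Prop. A3: *"HB = CB = Z⁻¹∫_{ℋ₀} exp(−½⟨x,Δx⟩ + ⟨x,B⟩)x dx"* — the Gaussian mean over ℋ₀ IS CB,
with the normalisation read Z(B) = ∫_{ℋ₀}exp(−½⟨x,Δx⟩ + ⟨x,B⟩)dx (TRANSCRIPT NOTE T5); *"so the integral in (A15) equals CB"*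
(p. 329, by (A19) and oddness). [cite: BalabanImbrieJaffe1985, Prop. A3 (A15) p.328] -/
theorem eqA15 (B : H) :
    (∫ x : LinearMap.ker V, Real.exp (-(1 / 2 : ℝ) * ⟪(x : H), Δ x⟫ + ⟪(x : H), B⟫))⁻¹
      • (∫ x : LinearMap.ker V, Real.exp (-(1 / 2 : ℝ) * ⟪(x : H), Δ x⟫ + ⟪(x : H), B⟫) • (x : H)) = C B := by
  have hCB : V (C B) = 0 := C_mem_H0 hΔ hV hA9 G hG P hP0 hP C hC hC7 B
  have hm : deltaK Δ V ⟨C B, LinearMap.mem_ker.mpr hCB⟩ = (LinearMap.ker V).orthogonalProjectionOnto B := by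
    have h := deltaK_PG hΔ hV G hG P hP0 hP B
    have e : (⟨C B, LinearMap.mem_ker.mpr hCB⟩ : LinearMap.ker V) = ⟨P (G B), LinearMap.mem_ker.mpr (hP0 (G B))⟩ := by
      apply Subtype.ext
      simp only [eqA13 hΔ hV hA9 G hG P hP0 hP C hC hC7, LinearMap.comp_apply]
    rw [e, h]
  have h := integral_gauss_smul_eq (deltaK Δ V) ((LinearMap.ker V).orthogonalProjectionOnto B) (deltaK_symm hΔ)
    one_pos (deltaK_coercive hA9) ⟨C B, LinearMap.mem_ker.mpr hCB⟩ hm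
  simp_rw [← exponent_eq] at h
  -- push the subtype inclusion ι : ℋ₀ → ℋ (a linear isometry) through the Bochner integral
  have hcoe : (∫ x : LinearMap.ker V, Real.exp (-(1 / 2 : ℝ) * ⟪(x : H), Δ x⟫ + ⟪(x : H), B⟫) • (x : H))
      = (((∫ x : LinearMap.ker V, Real.exp (-(1 / 2 : ℝ) * ⟪(x : H), Δ x⟫ + ⟪(x : H), B⟫) • x :
          LinearMap.ker V)) : H) := by
    have hι := (LinearMap.ker V).subtypeₗᵢ.integral_comp_comm (μ := (volume : Measure (LinearMap.ker V)))
      (fun x : LinearMap.ker V => Real.exp (-(1 / 2 : ℝ) * ⟪(x : H), Δ x⟫ + ⟪(x : H), B⟫) • x)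
    simpa only [Submodule.coe_subtypeₗᵢ, Submodule.coe_subtype, Submodule.coe_smul] using hι
  have hZ : (∫ x : LinearMap.ker V, Real.exp (-(1 / 2 : ℝ) * ⟪(x : H), Δ x⟫ + ⟪(x : H), B⟫)) ≠ 0 := by
    rw [eqA7_PG hΔ hV G hG P hP0 hP B]
    exact mul_ne_zero (Real.exp_pos _).ne' (Z_pos hA9).ne'
  rw [hcoe, h, Submodule.coe_smul, Subtype.coe_mk, smul_smul, inv_mul_cancel₀ hZ, one_smul]

include hΔ hV hA9 hG hP0 hP hC hC7 in
/-- (A15) with the B-INDEPENDENT Z of (A7) (TRANSCRIPT NOTE T5): Z⁻¹∫_{ℋ₀}exp(−½⟨x,Δx⟩ + ⟨x,B⟩)x dx = exp(½⟨B,CB⟩)·CB.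
[cite: BalabanImbrieJaffe1985, Prop. A3 (A15) p.328] -/
theorem eqA15_Z (B : H) :
    (∫ x : LinearMap.ker V, Real.exp (-(1 / 2 : ℝ) * ⟪(x : H), Δ x⟫))⁻¹
      • (∫ x : LinearMap.ker V, Real.exp (-(1 / 2 : ℝ) * ⟪(x : H), Δ x⟫ + ⟪(x : H), B⟫) • (x : H))
      = Real.exp ((1 / 2 : ℝ) * ⟪B, C B⟫) • C B := by
  have h := eqA15 hΔ hV hA9 G hG P hP0 hP C hC hC7 B
  have hZB := eqA7_PG hΔ hV G hG P hP0 hP B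
  have hZ := Z_pos (Δ := Δ) hA9
  have hZB0 : (∫ x : LinearMap.ker V, Real.exp (-(1 / 2 : ℝ) * ⟪(x : H), Δ x⟫ + ⟪(x : H), B⟫)) ≠ 0 := by
    rw [hZB]
    exact mul_ne_zero (Real.exp_pos _).ne' hZ.ne'
  have hI : (∫ x : LinearMap.ker V, Real.exp (-(1 / 2 : ℝ) * ⟪(x : H), Δ x⟫ + ⟪(x : H), B⟫) • (x : H))
      = (∫ x : LinearMap.ker V, Real.exp (-(1 / 2 : ℝ) * ⟪(x : H), Δ x⟫ + ⟪(x : H), B⟫)) • C B := by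
    rw [← h, smul_smul, mul_inv_cancel₀ hZB0, one_smul]
  rw [hI, hZB, smul_smul, inner_C_eq hΔ hV hA9 G hG P hP0 hP C hC7 B, mul_left_comm, inv_mul_cancel₀ hZ.ne',
    mul_one]

include hΔ hV hA9 hG hP0 hP hC hC7 in
/-- **Proposition A3** p. 328 [PDF 30] for THE MODEL INSTANCE: r15's `ConstrainedForm.PropA3` = (A13) ∧ (A14) ∧ (A15)–(A16)
holds for the carrier `model` built from the printed data (ℋ finite-dimensional, Δ, V symmetric with (A9), G = (Δ+V)⁻¹ (A11),
P the (A12)-orthogonal projection onto ℋ₀ = Null V, C defined by the Gaussian integral (A7) and self-adjoint, Δ₀ = Δ on ℋ₀ (A8)).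
[cite: BalabanImbrieJaffe1985, Prop. A3 p.328] -/
theorem propA3_model (Δ₀ : H →ₗ[ℝ] H) (hΔ₀ : ∀ x : H, V x = 0 → Δ₀ x = Δ x) : (model Δ V Δ₀ G P C).PropA3 := by
  have h13 := eqA13 hΔ hV hA9 G hG P hP0 hP C hC hC7
  unfold ConstrainedForm.PropA3 ConstrainedForm.EqA15A16
  refine ⟨h13, eqA14 hΔ hV hA9 G hG P hP0 hP C hC hC7 Δ₀ hΔ₀, ?_⟩
  show ∀ B : H, V (C B) = 0 ∧
    (∀ x : H, V x = 0 →
      (1 / 2 : ℝ) * ⟪C B, Δ (C B)⟫ - ⟪C B, B⟫ ≤ (1 / 2 : ℝ) * ⟪x, Δ x⟫ - ⟪x, B⟫) ∧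
    (∀ x : H, V x = 0 →
      (1 / 2 : ℝ) * ⟪x, Δ x⟫ - ⟪x, B⟫ = (1 / 2 : ℝ) * ⟪x - C B, Δ (x - C B)⟫ - (1 / 2 : ℝ) * ⟪B, C B⟫)
  intro B
  refine ⟨C_mem_H0 hΔ hV hA9 G hG P hP0 hP C hC hC7 B, fun x hx => ?_, fun x hx => ?_⟩
  · rw [h13, LinearMap.comp_apply]
    exact PG_min hΔ hV hA9 G hG P hP0 hP B x hx
  · rw [h13, LinearMap.comp_apply]
    exact eqA16 hΔ hV G hG P hP0 hP B x hx

end Measure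

end FinDim

end Hyps

end PropA3

end Literature.MathematicalPhysics.QuantumFieldTheory.BalabanImbrieJaffe1984to88.BIJ85PropA3Proof
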